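import Summits.QuantumFields.YangMills.Theorems.UnitScaleTiltProp7TwoBackgroundGradientComparison
import HarnessLib

/-!
# Route `UnitScaleTilt`, crux K1 «MinimiserStabilityRegPr» (stmt-QuantumFields-19200), EX row (5) `norm_G`, STOREY H, H-road brick H2 — **THE THREE TRANSPORTER ROWS OF print's Thm 3.1
# (`‖R(b)w − w‖ ≤ ε‖w‖`, `‖S(b)w − w‖ ≤ ε‖w‖`, `‖S(x,μ)w − S(x−e_μ,μ)w‖ ≤ ε′‖w‖` for `R = Ad V`, `S = Ad V⁻¹`) FROM THE BOND-MATRIX LETTERS OF A REGULAR GAUGE**: the small-field row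
# `‖V(b) − 1‖ ≤ ε₁` and the η²-Lipschitz row `‖V(x,μ) − V(x−e_μ,μ)‖ ≤ ε₁′` ([Balaban1985RegularSpaces] Thm 2 (1.36), the EX display's `hThm2S` currency) give lit's `hRε hSε hSε'` of
# ✓`Prop7ResolventHolderRowMember.holderRow_resolventCovDiv_member` with `ε := 2√2·ε₁`, `ε′ := 2√2·ε₁′` ([Balaban1985BackgroundPropagators] (3.35) p.396)

Cell `ym3-torus` (HUMAN RULING D-0037; rung R3 = SU(2) YM₃ on T³ — NOT d = 4, NOT infinite volume, NOT a mass gap, NOT Clay).  Width seat `ym3-torus-px19` (gen 15); chair WORD №46 (H2),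
19200 evidence `LOCATE-H2-HolderRow-px19g15.md` §1 rows `hRε hSε hSε'`.  THEOREMS ONLY (0 `def`, 0 `sorry`, default heartbeats); `--supports stmt-QuantumFields-19200 --as helper`; count-neutral.

THE MATHEMATICS.  `‖Ad(P)w − w‖ ≤ 2√2·‖P − 1‖·‖w‖` on the Frobenius fibre (✓`Prop7TwoBackgroundGradientComparison.norm_adBg_sub_self_le` ∕ `norm_adBgInv_sub_self_le`) and the two-bond row
`‖Ad(P)w − Ad(Q)w‖ ≤ 2√2·‖P − Q‖·‖w‖` (✓`norm_adBg_sub_adBg_le`); its inverse-transporter twin (§1, `‖P⁻¹ − Q⁻¹‖ = ‖(P − Q)*‖ = ‖P − Q‖` for unitaries) is the one letter not yet in the tree.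

WHAT IS PROVED (ns `Summit.QuantumFields.YangMills.Theorems.Prop7TransporterRowsOfSmallField`; member `F`, run `K`, background `V` in a given gauge).
* §1 ★ `norm_adBgInv_sub_adBgInv_le` — `‖Ad(V(p)⁻¹)w − Ad(V(p′)⁻¹)w‖ ≤ 2√2·‖V(p) − V(p′)‖·‖w‖`.
* §2 ★ `hRε_of_smallField`, ★ `hSε_of_smallField` (`ε := 2√2·ε₁` from `‖V(b) − 1‖ ≤ ε₁`), ★★ `hSε'_of_bondLipschitz` (`ε′ := 2√2·ε₁′` from `‖V(x,μ) − V(x−e_μ,μ)‖ ≤ ε₁′`) — lit's three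
  binders VERBATIM (shape of ✓`holderRow_resolventCovDiv_member`'s `hRε hSε hSε'`).
HYP-SAT (★★OWNER RULING №42).  The two bond-matrix rows are real inequalities, inhabited at `V = 1` with `ε₁ = ε₁′ = 0` and, K-free, by the Thm-2 regular representative (`hThm2S`); conclusions are
lit's transporter rows; nothing conclusion-shaped is assumed.
HONEST SCOPE.  Fibre algebra; the Thm-2 gauge itself, `Hflat`, `Hgrad`, `ω₁`'s row, `h3`, norm_G, EX, 19200, R3 are NOT proved; the Yang–Mills mass gap is NOT proved.

References: T. Bałaban, CMP **99** (1985) 389–434 [Balaban1985BackgroundPropagators] ((3.3) p.391, (3.8) p.392, (3.35) p.396); CMP **98** (1985) 17–51 [Balaban1985Averaging] ((18)–(20) p.21);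
CMP **102** (1985) 255–275 [Balaban1985RegularSpaces] ((1.36)–(1.37) p.82, Thm 2 p.83).
-/

set_option autoImplicit false

noncomputable section

open scoped InnerProductSpace ComplexConjugate BigOperators Matrix.Norms.L2Operator

namespace Summit.QuantumFields.YangMills.Theorems.Prop7TransporterRowsOfSmallField

open Literature.MathematicalPhysics.QuantumFieldTheory.Balaban1983to89
open Literature.MathematicalPhysics.QuantumFieldTheory.Balaban1983to89.T3ContinuumYM3Torus
open B4Sect5Torus (TSite)
open B9SectCLatticeCarrier (Bond unshift)
open Summit.QuantumFields.YangMills.Theorems.Prop7SectET3Transport (periodsT3 bgOfCfg isUnitaryBg_bgOfCfg)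
open Summit.QuantumFields.YangMills.Theorems.Prop7SectET3HilbertLetters (W₂ adW adBg adBgInv)
open Summit.QuantumFields.YangMills.Theorems.PoincareLipschitzCovariantBridge (norm_adW_sub_self_le adW_mul norm_adW mem_unitary_coe_inv inv_eq_star_mul inv_eq_star_inv)
open Summit.QuantumFields.YangMills.Theorems.Prop7TwoBackgroundGradientComparison (norm_adBg_sub_self_le norm_adBgInv_sub_self_le norm_adBg_sub_adBg_le)

variable (F : T3Family) (K : ℕ)

/-! ## §1 The two-bond row of the inverse transporter -/

/-- ★ **TWO BONDS, INVERSE TRANSPORTER**: `‖Ad(V(p)⁻¹)w − Ad(V(p′)⁻¹)w‖ ≤ 2√2·‖V(p) − V(p′)‖·‖w‖` — the proof of ✓`norm_adBg_sub_adBg_le` at the inverse units `P⁻¹, Q⁻¹` (unitary: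
`(P⁻¹)⁻¹ = (P⁻¹)*`), and `‖P⁻¹ − Q⁻¹‖ = ‖P* − Q*‖ = ‖P − Q‖`. [cite: Balaban1985Averaging, (18)–(20) p.21; Balaban1985BackgroundPropagators, (3.8) p.392] -/
theorem norm_adBgInv_sub_adBgInv_le (V : GaugeField (F.P K) 0 (Matrix.specialUnitaryGroup (Fin 2) ℂ)) (p p' : Bond 3 (periodsT3 F K)) (w : W₂) :
    ‖adBgInv F K V p w - adBgInv F K V p' w‖ ≤ 2 * Real.sqrt 2 *
      ‖((bgOfCfg F K V p : (Matrix (Fin 2) (Fin 2) ℂ)ˣ) : Matrix (Fin 2) (Fin 2) ℂ) - ((bgOfCfg F K V p' : (Matrix (Fin 2) (Fin 2) ℂ)ˣ) : Matrix (Fin 2) (Fin 2) ℂ)‖ * ‖w‖ := by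
  set P₀ : (Matrix (Fin 2) (Fin 2) ℂ)ˣ := bgOfCfg F K V p with hP₀def
  set Q₀ : (Matrix (Fin 2) (Fin 2) ℂ)ˣ := bgOfCfg F K V p' with hQ₀def
  have hP₀ : (((P₀⁻¹ : (Matrix (Fin 2) (Fin 2) ℂ)ˣ) : Matrix (Fin 2) (Fin 2) ℂ)) = star (P₀ : Matrix (Fin 2) (Fin 2) ℂ) := isUnitaryBg_bgOfCfg F K V p
  have hQ₀ : (((Q₀⁻¹ : (Matrix (Fin 2) (Fin 2) ℂ)ˣ) : Matrix (Fin 2) (Fin 2) ℂ)) = star (Q₀ : Matrix (Fin 2) (Fin 2) ℂ) := isUnitaryBg_bgOfCfg F K V p'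
  -- the inverse units are unitary as well
  set P : (Matrix (Fin 2) (Fin 2) ℂ)ˣ := P₀⁻¹ with hPdef
  set Q : (Matrix (Fin 2) (Fin 2) ℂ)ˣ := Q₀⁻¹ with hQdef
  have hP : (((P⁻¹ : (Matrix (Fin 2) (Fin 2) ℂ)ˣ) : Matrix (Fin 2) (Fin 2) ℂ)) = star (P : Matrix (Fin 2) (Fin 2) ℂ) := inv_eq_star_inv P₀ hP₀
  have hQ : (((Q⁻¹ : (Matrix (Fin 2) (Fin 2) ℂ)ˣ) : Matrix (Fin 2) (Fin 2) ℂ)) = star (Q : Matrix (Fin 2) (Fin 2) ℂ) := inv_eq_star_inv Q₀ hQ₀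
  have hQi : ((((Q⁻¹)⁻¹ : (Matrix (Fin 2) (Fin 2) ℂ)ˣ)) : Matrix (Fin 2) (Fin 2) ℂ) = star (((Q⁻¹ : (Matrix (Fin 2) (Fin 2) ℂ)ˣ)) : Matrix (Fin 2) (Fin 2) ℂ) :=
    inv_eq_star_inv Q hQ
  have hid : adW P w - adW Q w = adW Q (adW (Q⁻¹ * P) w - w) := by
    rw [map_sub, ← adW_mul, ← mul_assoc, mul_inv_cancel, one_mul]
  have h1 : ‖adW Q (adW (Q⁻¹ * P) w - w)‖ = ‖adW (Q⁻¹ * P) w - w‖ := norm_adW Q hQ _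
  have h2 := norm_adW_sub_self_le (Q⁻¹ * P) (inv_eq_star_mul _ _ hQi hP) w
  have h3 : ‖(((Q⁻¹ * P : (Matrix (Fin 2) (Fin 2) ℂ)ˣ)) : Matrix (Fin 2) (Fin 2) ℂ) - 1‖ ≤ ‖(P : Matrix (Fin 2) (Fin 2) ℂ) - (Q : Matrix (Fin 2) (Fin 2) ℂ)‖ := by
    have e : (((Q⁻¹ * P : (Matrix (Fin 2) (Fin 2) ℂ)ˣ)) : Matrix (Fin 2) (Fin 2) ℂ) - 1
        = (((Q⁻¹ : (Matrix (Fin 2) (Fin 2) ℂ)ˣ)) : Matrix (Fin 2) (Fin 2) ℂ) * ((P : Matrix (Fin 2) (Fin 2) ℂ) - (Q : Matrix (Fin 2) (Fin 2) ℂ)) := by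
      rw [Units.val_mul, Matrix.mul_sub, Units.inv_mul]
    rw [e]
    calc ‖(((Q⁻¹ : (Matrix (Fin 2) (Fin 2) ℂ)ˣ)) : Matrix (Fin 2) (Fin 2) ℂ) * ((P : Matrix (Fin 2) (Fin 2) ℂ) - (Q : Matrix (Fin 2) (Fin 2) ℂ))‖
        ≤ ‖(((Q⁻¹ : (Matrix (Fin 2) (Fin 2) ℂ)ˣ)) : Matrix (Fin 2) (Fin 2) ℂ)‖ * ‖(P : Matrix (Fin 2) (Fin 2) ℂ) - (Q : Matrix (Fin 2) (Fin 2) ℂ)‖ := norm_mul_le _ _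
      _ = ‖(P : Matrix (Fin 2) (Fin 2) ℂ) - (Q : Matrix (Fin 2) (Fin 2) ℂ)‖ := by
          rw [CStarRing.norm_of_mem_unitary (mem_unitary_coe_inv Q hQ), one_mul]
  -- `‖P₀⁻¹ − Q₀⁻¹‖ = ‖P₀ − Q₀‖`
  have h4 : ‖(P : Matrix (Fin 2) (Fin 2) ℂ) - (Q : Matrix (Fin 2) (Fin 2) ℂ)‖ = ‖(P₀ : Matrix (Fin 2) (Fin 2) ℂ) - (Q₀ : Matrix (Fin 2) (Fin 2) ℂ)‖ := by
    rw [hPdef, hQdef, hP₀, hQ₀, ← star_sub, Matrix.star_eq_conjTranspose, Matrix.l2_opNorm_conjTranspose]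
  show ‖adW P w - adW Q w‖ ≤ 2 * Real.sqrt 2 * ‖(P₀ : Matrix (Fin 2) (Fin 2) ℂ) - (Q₀ : Matrix (Fin 2) (Fin 2) ℂ)‖ * ‖w‖
  rw [hid, h1, ← h4]
  calc ‖adW (Q⁻¹ * P) w - w‖ ≤ 2 * Real.sqrt 2 * ‖(((Q⁻¹ * P : (Matrix (Fin 2) (Fin 2) ℂ)ˣ)) : Matrix (Fin 2) (Fin 2) ℂ) - 1‖ * ‖w‖ := h2
    _ ≤ 2 * Real.sqrt 2 * ‖(P : Matrix (Fin 2) (Fin 2) ℂ) - (Q : Matrix (Fin 2) (Fin 2) ℂ)‖ * ‖w‖ := by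
        have h0 : 0 ≤ 2 * Real.sqrt 2 := by positivity
        exact mul_le_mul_of_nonneg_right (mul_le_mul_of_nonneg_left h3 h0) (norm_nonneg _)

/-! ## §2 lit's three transporter rows from the bond-matrix letters of a regular gauge -/

/-- ★ **`hRε`**: `‖V(b) − 1‖ ≤ ε₁` for all bonds ⟹ `‖Ad(V(b))w − w‖ ≤ (2√2·ε₁)·‖w‖`. [cite: Balaban1985BackgroundPropagators, (3.35) p.396; Balaban1985RegularSpaces, (1.36) p.82] -/
theorem hRε_of_smallField (V : GaugeField (F.P K) 0 (Matrix.specialUnitaryGroup (Fin 2) ℂ)) {ε₁ : ℝ}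
    (hV : ∀ b : Bond 3 (periodsT3 F K), ‖((bgOfCfg F K V b : (Matrix (Fin 2) (Fin 2) ℂ)ˣ) : Matrix (Fin 2) (Fin 2) ℂ) - 1‖ ≤ ε₁) :
    ∀ (b : Bond 3 (periodsT3 F K)) (w : W₂), ‖adBg F K V b w - w‖ ≤ (2 * Real.sqrt 2 * ε₁) * ‖w‖ := by
  intro b w
  calc ‖adBg F K V b w - w‖ ≤ 2 * Real.sqrt 2 * ‖((bgOfCfg F K V b : (Matrix (Fin 2) (Fin 2) ℂ)ˣ) : Matrix (Fin 2) (Fin 2) ℂ) - 1‖ * ‖w‖ := norm_adBg_sub_self_le F K V b w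
    _ ≤ (2 * Real.sqrt 2 * ε₁) * ‖w‖ := by
        have h0 : 0 ≤ 2 * Real.sqrt 2 := by positivity
        exact mul_le_mul_of_nonneg_right (mul_le_mul_of_nonneg_left (hV b) h0) (norm_nonneg _)

/-- ★ **`hSε`**: `‖V(b) − 1‖ ≤ ε₁` for all bonds ⟹ `‖Ad(V(b)⁻¹)w − w‖ ≤ (2√2·ε₁)·‖w‖`. [cite: Balaban1985BackgroundPropagators, (3.35) p.396; Balaban1985RegularSpaces, (1.36) p.82] -/
theorem hSε_of_smallField (V : GaugeField (F.P K) 0 (Matrix.specialUnitaryGroup (Fin 2) ℂ)) {ε₁ : ℝ}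
    (hV : ∀ b : Bond 3 (periodsT3 F K), ‖((bgOfCfg F K V b : (Matrix (Fin 2) (Fin 2) ℂ)ˣ) : Matrix (Fin 2) (Fin 2) ℂ) - 1‖ ≤ ε₁) :
    ∀ (b : Bond 3 (periodsT3 F K)) (w : W₂), ‖adBgInv F K V b w - w‖ ≤ (2 * Real.sqrt 2 * ε₁) * ‖w‖ := by
  intro b w
  calc ‖adBgInv F K V b w - w‖ ≤ 2 * Real.sqrt 2 * ‖((bgOfCfg F K V b : (Matrix (Fin 2) (Fin 2) ℂ)ˣ) : Matrix (Fin 2) (Fin 2) ℂ) - 1‖ * ‖w‖ := norm_adBgInv_sub_self_le F K V b w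
    _ ≤ (2 * Real.sqrt 2 * ε₁) * ‖w‖ := by
        have h0 : 0 ≤ 2 * Real.sqrt 2 := by positivity
        exact mul_le_mul_of_nonneg_right (mul_le_mul_of_nonneg_left (hV b) h0) (norm_nonneg _)

/-- ★★ **`hSε'`**: the η²-LIPSCHITZ row of the gauge field `‖V(x,μ) − V(x−e_μ,μ)‖ ≤ ε₁′` (print's (3.35)₂; Thm-2's `|∇A|` row) ⟹ `‖Ad(V(x,μ)⁻¹)w − Ad(V(x−e_μ,μ)⁻¹)w‖ ≤ (2√2·ε₁′)·‖w‖`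
(§1). [cite: Balaban1985BackgroundPropagators, (3.35) p.396; Balaban1985RegularSpaces, (1.36)–(1.37) p.82] -/
theorem hSε'_of_bondLipschitz (V : GaugeField (F.P K) 0 (Matrix.specialUnitaryGroup (Fin 2) ℂ)) {ε₁' : ℝ}
    (hV' : ∀ (x : TSite 3 (periodsT3 F K)) (μ : Fin 3),
      ‖((bgOfCfg F K V (x, μ) : (Matrix (Fin 2) (Fin 2) ℂ)ˣ) : Matrix (Fin 2) (Fin 2) ℂ) - ((bgOfCfg F K V (unshift μ x, μ) : (Matrix (Fin 2) (Fin 2) ℂ)ˣ) : Matrix (Fin 2) (Fin 2) ℂ)‖ ≤ ε₁') :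
    ∀ (x : TSite 3 (periodsT3 F K)) (μ : Fin 3) (w : W₂), ‖adBgInv F K V (x, μ) w - adBgInv F K V (unshift μ x, μ) w‖ ≤ (2 * Real.sqrt 2 * ε₁') * ‖w‖ := by
  intro x μ w
  calc ‖adBgInv F K V (x, μ) w - adBgInv F K V (unshift μ x, μ) w‖
      ≤ 2 * Real.sqrt 2 * ‖((bgOfCfg F K V (x, μ) : (Matrix (Fin 2) (Fin 2) ℂ)ˣ) : Matrix (Fin 2) (Fin 2) ℂ) - ((bgOfCfg F K V (unshift μ x, μ) : (Matrix (Fin 2) (Fin 2) ℂ)ˣ) : Matrix (Fin 2) (Fin 2) ℂ)‖ * ‖w‖ :=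
        norm_adBgInv_sub_adBgInv_le F K V (x, μ) (unshift μ x, μ) w
    _ ≤ (2 * Real.sqrt 2 * ε₁') * ‖w‖ := by
        have h0 : 0 ≤ 2 * Real.sqrt 2 := by positivity
        exact mul_le_mul_of_nonneg_right (mul_le_mul_of_nonneg_left (hV' x μ) h0) (norm_nonneg _)

end Summit.QuantumFields.YangMills.Theorems.Prop7TransporterRowsOfSmallField

end
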